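import Literature.AlgebraicGeometry.Resolution.BlowupCharts
import Literature.AlgebraicGeometry.Resolution.DerivativeIdealsChartIter
import Literature.AlgebraicGeometry.Resolution.TangentDirections
import Literature.AlgebraicGeometry.Resolution.DerivativeIdealsSupport
import Literature.AlgebraicGeometry.Resolution.MarkedResolutions
import Literature.AlgebraicGeometry.Resolution.BlowupsProperProofs
import HarnessLib

/-!
# BGMW Lemma 3.5.3 and Lemma 3.6.2 on the blow-up (sheaf level)

Topic: `Literature/AlgebraicGeometry/Resolution`. Bierstone–Grigoriev–Milman–Włodarczyk,
*Effective Hironaka resolution and its complexity (with appendix on applications in positive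
characteristic)*, arXiv:1206.3090, §3.5–§3.6 (arXiv numbering):

* **Lemma 3.5.3** (Giraud, Villamayor): "Let `(𝓘, μ)` be a marked ideal, `C ⊂ supp(𝓘, μ)` a
  smooth center, and `r ≤ μ`. Let `σ : X ← X'` be a blow-up at `C`. Then
  `σᶜ(𝒟ʳ(𝓘, μ)) ⊆ 𝒟ʳ(σᶜ(𝓘, μ))`."
* **Lemma 3.6.2** (Villamayor): "Let `(𝓘, μ)` be a marked ideal of maximal order and let
  `C ⊂ supp(𝓘, μ)` be a smooth center. Let `σ : X ← X'` be a blow-up at `C`. Then `σᶜ(𝓘, μ)` is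
  of maximal order." (Proof printed: "`𝒟^μ(σᶜ(𝓘, μ)) ⊃ σᶜ(𝒟^μ(𝓘), 0) = 𝒪_X`.")

Both are PROVED here at the level of ideal SHEAVES, for a blow-up in the sense of the universal
property (`IsBlowup π C`, `Blowups.lean`) of a scheme `X` with `k`-structure
`φ : k → Γ(X, 𝒪_X)` (`DerivativeIdealSheaf.lean`; `X'` carries the induced `k`-structure
`π.appTop.hom.comp φ = π^* ∘ φ`), the derivative ideal sheaves `𝒟ʳ = derivIdealSheafIter`
(BGMW Def. 3.5.1) and the controlled transform `σᶜ(𝓘, μ) = (σ^*𝓘 : 𝓘(D)^μ)`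
(`controlledTransform`, `MarkedIdeals.lean`). The hypothesis "`C ⊂ supp(𝓘, μ)` a smooth center"
enters only through `𝓘 ⊆ 𝓘_C^μ` (BGMW Lemma 3.2.1 (1), `MarkedIdeal.ideal_le_pow` in the tree),
which is what is assumed; the standing finiteness hypothesis of `DerivativeIdealSheaf.lean`
(finitely presented differentials on `X` and `X'`, automatic for varieties) and `X'` locally
Noetherian (sections of colon ideal sheaves, `ideal_colon`) are assumed explicitly.
Characteristic-free (as printed: Lemma 3.5.3 holds in every characteristic).

Proof: an inclusion of ideal sheaves is local; on a chart `V = Spec Γ(X, U)[C(U)/b]` of the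
blow-up (`IsBlowup.exists_chart`, `BlowupCharts.lean`: `Γ(X', V) ≅ R[I/b]` over `R = Γ(X, U)`,
`I = C(U)`) the sections of both sides are the chart-level ideals of
`DerivativeIdealsChartIter.lean` (`𝒟` commutes with sections, `derivIdealSheafIter_ideal`;
colon ideal sheaves and inverse images are computed sectionwise, `ideal_colon`,
`ideal_comap_of_le`), and the chart-level Lemma 3.5.3
(`colon_map_derivIdealIter_le_derivIdealIter_colon`: `I·S = (b)` with `b` regular, every `b·δ`
extends to a derivation of `S = R[I/b]`) applies after transport along `Γ(X', V) ≅ R[I/b]`.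

## Content

* `π.appTop.hom.comp φ` — the induced `k`-structure `π^* ∘ φ` on `X'`; `appLE_comp_sectionsHom`,
  `appLE_sectionsHom` (`π^* : Γ(X, U) → Γ(X', V)` is a `k`-algebra map); `chart_hypotheses`
  (the hypotheses of the chart-level lemma hold on the charts of `BlowupCharts.lean`).
* `Derivation.transportRingEquiv` — transport of a derivation along a `k`-compatible ring
  isomorphism [folklore].
* `IsBlowup.controlledTransform_derivIdealSheafIter_le` — **Lemma 3.5.3**:
  `σᶜ(𝒟ʳ𝓘, μ - r) ⊆ 𝒟ʳ(σᶜ(𝓘, μ))` for `𝓘 ⊆ C^μ`, `r ≤ μ`;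
  `IsBlowup.transform_deriv_ideal_le` — the same for marked ideals
  (`σᶜ(𝒟ʳ(𝓘, μ)) ⊆ 𝒟ʳ(σᶜ(𝓘, μ))`, admissible centre).
* `IsBlowup.isOfMaxOrder_transform` — **Lemma 3.6.2**: the transform of a marked ideal of
  maximal order by the blow-up of an admissible centre is of maximal order.
* `appTop_comp_overHom`, `IsBlowup.controlledTransform_derivIdealSheafIter_le_over`,
  `IsBlowup.isOfMaxOrder_transform_over` — the same for morphisms of schemes locally of finite
  presentation over `Spec k` (`X.Over (Spec k)`, `π.IsOver (Spec k)`), where the finiteness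
  hypothesis is automatic (`hasFinitePresentationDifferentials_overHom`).
* `hasFinitePresentationDifferentials_appTop_comp_overHom`, `IsMultipleBlowup.isOfMaxOrder` — **Lemma 3.6.2 along a multiple blow-up** (`IsMultipleBlowup`,
  Def. 3.1.3): over a field `k`, for `X` locally Noetherian and locally of finite type over
  `Spec k`, all marked ideals of a multiple blow-up of a marked ideal of maximal order are of
  maximal order.

## Sources

* [BGMW 2011] §3.2 Lemma 3.2.1, §3.5 Def. 3.5.1 and Lemma 3.5.3, §3.6 Def. 3.6.1 and
  Lemma 3.6.2 (arXiv:1206.3090, pp. 7–8). [BierstoneGrigorievMilmanWlodarczyk2011]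
-/

noncomputable section

open CategoryTheory CategoryTheory.Limits AlgebraicGeometry TopologicalSpace
open scoped nonZeroDivisors

namespace Literature.AlgebraicGeometry.Resolution

universe u v

/-! ## Transport of derivations along ring isomorphisms -/

section Transport

variable {k : Type*} [CommRing k] {S B : Type*} [CommRing S] [CommRing B] [Algebra k S]
  [Algebra k B]

/-- **Transport of a `k`-derivation along a ring isomorphism compatible with the
`k`-structures**: for `e : S ≃ B` and a `k`-derivation `D₀` of `B` there is a `k`-derivation `D`
of `S` with `D(s) = e⁻¹(D₀(e s))`. [folklore] -/
theorem Derivation.exists_transport_ringEquiv (e : S ≃+* B)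
    (he : ∀ c : k, e (algebraMap k S c) = algebraMap k B c) (D₀ : Derivation k B B) :
    ∃ D : Derivation k S S, ∀ s : S, D s = e.symm (D₀ (e s)) := by
  refine ⟨Derivation.mk'
    { toFun := fun s => e.symm (D₀ (e s))
      map_add' := fun s t => by simp only [map_add]
      map_smul' := fun c s => by
        have he' : e.symm (algebraMap k B c) = algebraMap k S c := by
          rw [← he, e.symm_apply_apply]
        simp only [RingHom.id_apply, Algebra.smul_def, map_mul, he]
        rw [show algebraMap k B c * e s = c • e s from (Algebra.smul_def c (e s)).symm,
          D₀.map_smul, Algebra.smul_def, map_mul, he'] }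
    (fun s t => by
      simp only [LinearMap.coe_mk, AddHom.coe_mk, map_mul, Derivation.leibniz, smul_eq_mul,
        map_add, e.symm_apply_apply]), fun s => rfl⟩

end Transport

/-! ## The induced `k`-structure on the blow-up -/

section KStructure

variable {k : Type v} [CommRing k] {X X' : Scheme.{u}} (φ : k →+* Γ(X, ⊤)) (π : X' ⟶ X)

/-- `π^* : Γ(X, U) → Γ(X', V)` (`π(V) ⊆ U`) is a `k`-algebra map for the `k`-structure
`π^* ∘ φ : k → Γ(X, 𝒪_X) → Γ(X', 𝒪_{X'})` of `X'` induced along `π`. [folklore] -/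
theorem appLE_comp_sectionsHom (U : X.Opens) (V : X'.Opens) (hVU : V ≤ π ⁻¹ᵁ U) :
    (π.appLE U V hVU).hom.comp (sectionsHom φ U) = sectionsHom (π.appTop.hom.comp φ) V := by
  have h1 : π.appTop ≫ X'.presheaf.map (homOfLE (le_top : V ≤ ⊤)).op = π.appLE ⊤ V le_top := by
    have : π.appTop = π.appLE ⊤ ⊤ le_top := Scheme.Hom.app_eq_appLE π
    rw [this, Scheme.Hom.appLE_map]
  have h2 : X.presheaf.map (homOfLE (le_top : U ≤ ⊤)).op ≫ π.appLE U V hVU = π.appLE ⊤ V le_top :=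
    Scheme.Hom.map_appLE π hVU _
  unfold sectionsHom
  rw [← RingHom.comp_assoc, ← RingHom.comp_assoc, ← CommRingCat.hom_comp, ← CommRingCat.hom_comp,
    h1, h2]

/-- Pointwise form: `π^*` commutes with the `k`-structures. [folklore] -/
theorem appLE_sectionsHom (U : X.Opens) (V : X'.Opens) (hVU : V ≤ π ⁻¹ᵁ U) (c : k) :
    π.appLE U V hVU (sectionsHom φ U c) = sectionsHom (π.appTop.hom.comp φ) V c :=
  RingHom.congr_fun (appLE_comp_sectionsHom φ π U V hVU) c

/-- The induced `k`-structure along the identity. [folklore] -/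
theorem id_appTop_comp : (𝟙 X : X ⟶ X).appTop.hom.comp φ = φ := by
  rw [Scheme.Hom.id_appTop, CommRingCat.hom_id, RingHom.id_comp]

/-- The induced `k`-structure along a composite. [folklore] -/
theorem comp_appTop_comp {X'' : Scheme.{u}} (τ : X'' ⟶ X') :
    (τ ≫ π).appTop.hom.comp φ = τ.appTop.hom.comp (π.appTop.hom.comp φ) := by
  rw [Scheme.Hom.comp_appTop, CommRingCat.hom_comp, RingHom.comp_assoc]

end KStructure

/-! ## BGMW Lemma 3.5.3 on the blow-up -/

section Lemma353

variable {k : Type v} [CommRing k] {X X' : Scheme.{u}} {φ : k →+* Γ(X, ⊤)} {π : X' ⟶ X}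
  {C : X.IdealSheafData}

/-- **The chart hypotheses on a chart of the blow-up.** On an affine open `V ⊆ X'` over the
affine open `U ⊆ X` with `Γ(X', V) ≅ Γ(X, U)[C(U)/b]` over `Γ(X, U)` (`IsBlowup.exists_chart`):
`π^*b` is a nonzerodivisor generating `C(U)·Γ(X', V)`, and for every `k`-derivation `δ` of
`Γ(X, U)` the derivation `b·δ` extends to a `k`-derivation of `Γ(X', V)`
(`exists_derivation_blowupAlgebra` transported along the isomorphism). Stated for algebra
structures `k → Γ(X, U) → Γ(X', V)` equal to the `k`-structures `φ`, `π^* ∘ φ` and to `π^*`.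
[folklore] -/
theorem chart_hypotheses (U : X.affineOpens) (V : X'.affineOpens)
    (hVU : (V : X'.Opens) ≤ π ⁻¹ᵁ (U : X.Opens)) {b : Γ(X, U)} (hb : b ∈ C.ideal U)
    (e : Γ(X', V) ≃+* blowupAlgebra (C.ideal U) b)
    (he : e.toRingHom.comp (π.appLE U V hVU).hom = algebraMap Γ(X, U) (blowupAlgebra (C.ideal U) b))
    [Algebra k Γ(X, U)] [Algebra k Γ(X', V)] [Algebra Γ(X, U) Γ(X', V)]
    (halg : algebraMap Γ(X, U) Γ(X', V) = (π.appLE U V hVU).hom)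
    (hkU : algebraMap k Γ(X, U) = sectionsHom φ U)
    (hkV : algebraMap k Γ(X', V) = sectionsHom (π.appTop.hom.comp φ) V) :
    algebraMap Γ(X, U) Γ(X', V) b ∈ Γ(X', V)⁰ ∧
      (C.ideal U).map (algebraMap Γ(X, U) Γ(X', V)) =
          Ideal.span {algebraMap Γ(X, U) Γ(X', V) b} ∧
        ∀ δ : Derivation k Γ(X, U) Γ(X, U), ∃ D : Derivation k Γ(X', V) Γ(X', V),
          ∀ r : Γ(X, U), D (algebraMap Γ(X, U) Γ(X', V) r) =
            algebraMap Γ(X, U) Γ(X', V) b * algebraMap Γ(X, U) Γ(X', V) (δ r) := by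
  have hψ : ∀ r : Γ(X, U), e (algebraMap Γ(X, U) Γ(X', V) r) =
      algebraMap Γ(X, U) (blowupAlgebra (C.ideal U) b) r := fun r => by
    rw [halg]
    exact RingHom.congr_fun he r
  have hψ' : ∀ r : Γ(X, U), algebraMap Γ(X, U) Γ(X', V) r =
      e.symm (algebraMap Γ(X, U) (blowupAlgebra (C.ideal U) b) r) := fun r => by
    rw [← hψ, e.symm_apply_apply]
  -- `k`-compatibility of `e`
  haveI : IsScalarTower k Γ(X, U) Γ(X', V) := IsScalarTower.of_algebraMap_eq fun c => by
    rw [hkU, hkV, halg]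
    exact (appLE_sectionsHom φ π U V hVU c).symm
  have hek : ∀ c : k, e (algebraMap k Γ(X', V) c) =
      algebraMap k (blowupAlgebra (C.ideal U) b) c := fun c => by
    rw [IsScalarTower.algebraMap_apply k Γ(X, U) Γ(X', V), hψ, ← IsScalarTower.algebraMap_apply]
  refine ⟨?_, ?_, ?_⟩
  · -- `b` is a nonzerodivisor
    rw [hψ']
    exact mem_nonZeroDivisors_of_inverse e.symm.toRingHom e.toRingHom
      (fun a => e.apply_symm_apply a) (fun a => e.symm_apply_apply a)
      algebraMap_mem_nonZeroDivisors_blowupAlgebra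
  · -- `C(U)·Γ(X', V) = (b)`
    have h1 : ((C.ideal U).map (algebraMap Γ(X, U) Γ(X', V))).map e.toRingHom =
        (Ideal.span {algebraMap Γ(X, U) Γ(X', V) b}).map e.toRingHom := by
      rw [Ideal.map_map, halg, he, map_blowupAlgebra_eq_span hb, Ideal.map_span,
        Set.image_singleton]
      change _ = Ideal.span {e ((π.appLE U V hVU).hom b)}
      rw [← halg, hψ]
    have h2 := congrArg (Ideal.map e.symm.toRingHom) h1
    simp only [RingEquiv.toRingHom_eq_coe, Ideal.map_of_equiv] at h2
    exact h2
  · -- derivations `b·δ` extend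
    intro δ
    obtain ⟨D₀, hD₀⟩ := exists_derivation_blowupAlgebra (I := C.ideal U) (a := b) k δ
    obtain ⟨D, hD⟩ := Derivation.exists_transport_ringEquiv e hek D₀
    refine ⟨D, fun r => ?_⟩
    rw [hD, hψ, hD₀, map_mul, ← hψ', ← hψ']

variable [IsLocallyNoetherian X']

/-- **BGMW Lemma 3.5.3 on the blow-up** (Giraud, Villamayor; sheaf level): let `π : X' → X` be a
blow-up along `C` of a scheme with `k`-structure `φ` (finitely presented differentials on `X` and
`X'`, `X'` locally Noetherian), and `𝓘 ⊆ C^μ` an ideal sheaf (e.g. `C ⊆ supp(𝓘, μ)` an admissible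
centre, Lemma 3.2.1 (1)). Then for every `r ≤ μ` the controlled transform of `(𝒟ʳ𝓘, μ - r)` is
contained in the `r`-th derivative ideal sheaf of the controlled transform of `(𝓘, μ)`:
`σᶜ(𝒟ʳ(𝓘, μ)) = (σ^*𝒟ʳ𝓘 : 𝓘(D)^{μ-r}) ⊆ 𝒟ʳ((σ^*𝓘 : 𝓘(D)^μ)) = 𝒟ʳ(σᶜ(𝓘, μ))`. Every characteristic.
[cite: BierstoneGrigorievMilmanWlodarczyk2011, Lemma 3.5.3] -/
theorem IsBlowup.controlledTransform_derivIdealSheafIter_le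
    (hX : HasFinitePresentationDifferentials φ)
    (hX' : HasFinitePresentationDifferentials (π.appTop.hom.comp φ)) (hπ : IsBlowup π C)
    {I : X.IdealSheafData} {μ : ℕ} (hI : I ≤ C ^ μ) {r : ℕ} (hr : r ≤ μ) :
    controlledTransform π C (derivIdealSheafIter φ r I) (μ - r) ≤
      derivIdealSheafIter (π.appTop.hom.comp φ) r (controlledTransform π C I μ) := by
  -- cover `X'` by charts
  choose U V hVU b hb e hxV he using fun x' : X' => hπ.exists_chart x'
  have hcov : ⨆ x', (V x' : X'.Opens) = ⊤ :=
    top_le_iff.mp fun x _ => Opens.mem_iSup.mpr ⟨x, hxV x⟩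
  refine Scheme.IdealSheafData.le_of_iSup_eq_top V hcov fun x => ?_
  -- on the chart `V x → U x`
  letI := sectionsAlgebra φ (U x)
  letI := sectionsAlgebra (π.appTop.hom.comp φ) (V x)
  letI alg : Algebra Γ(X, U x) Γ(X', V x) := (π.appLE (U x) (V x) (hVU x)).hom.toAlgebra
  obtain ⟨ha, hIb, hext⟩ :=
    chart_hypotheses (φ := φ) (U x) (V x) (hVU x) (hb x) (e x) (he x) rfl rfl rfl
  have hJ : I.ideal (U x) ≤ C.ideal (U x) ^ μ := by
    have := hI (U x)
    rwa [Scheme.IdealSheafData.ideal_pow, Pi.pow_apply] at this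
  have key := colon_map_derivIdealIter_le_derivIdealIter_colon (k := k) (J := I.ideal (U x))
    ha hIb hext hJ hr
  rw [controlledTransform, controlledTransform, derivIdealSheafIter_ideal hX', ideal_colon,
    ideal_colon, Scheme.IdealSheafData.ideal_pow, Scheme.IdealSheafData.ideal_pow, Pi.pow_apply,
    Pi.pow_apply, ideal_comap_of_le π _ (U x) (V x) (hVU x),
    ideal_comap_of_le π _ (U x) (V x) (hVU x), ideal_comap_of_le π _ (U x) (V x) (hVU x),
    derivIdealSheafIter_ideal hX]
  change Submodule.colon ((derivIdealIter k r (I.ideal (U x))).map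
      (algebraMap Γ(X, U x) Γ(X', V x)))
      ↑((C.ideal (U x)).map (algebraMap Γ(X, U x) Γ(X', V x)) ^ (μ - r)) ≤
    derivIdealIter k r (Submodule.colon ((I.ideal (U x)).map (algebraMap Γ(X, U x) Γ(X', V x)))
      ↑((C.ideal (U x)).map (algebraMap Γ(X, U x) Γ(X', V x)) ^ μ))
  rw [hIb, Ideal.span_singleton_pow, Ideal.span_singleton_pow, Submodule.colon_span,
    Submodule.colon_span]
  exact key

end Lemma353

/-! ## Marked ideals: Lemma 3.5.3 and Lemma 3.6.2 for the transform by an admissible blow-up -/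

section Marked

variable {k : Type v} [CommRing k] {X X' : Scheme.{u}} [IsLocallyNoetherian X']
  {φ : k →+* Γ(X, ⊤)} {π : X' ⟶ X} {C : X.IdealSheafData}

/-- **BGMW Lemma 3.5.3 for marked ideals**: for an admissible centre `C` of `M = (𝓘, E, μ)`
(`C ⊆ supp(M)` having simple normal crossings with `E`) and a blow-up `π` along `C`,
`σᶜ(𝒟ʳ(𝓘, μ)) ⊆ 𝒟ʳ(σᶜ(𝓘, μ))` for `r ≤ μ` — the ideal of the transform of the marked derivative
`𝒟ʳ(M) = (𝒟ʳ𝓘, E, μ - r)` lies in `𝒟ʳ` of the ideal of the transform of `M`.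
[cite: BierstoneGrigorievMilmanWlodarczyk2011, Lemma 3.5.3] -/
theorem IsBlowup.transform_deriv_ideal_le (hX : HasFinitePresentationDifferentials φ)
    (hX' : HasFinitePresentationDifferentials (π.appTop.hom.comp φ)) (hπ : IsBlowup π C)
    (M : MarkedIdeal X) (hsupp : (C.support : Set X) ⊆ M.support) (hsnc : HasSNCWith M.boundary C)
    {r : ℕ} (hr : r ≤ M.mult) :
    ((M.deriv φ r).transform π C).ideal ≤
      derivIdealSheafIter (π.appTop.hom.comp φ) r ((M.transform π C).ideal) := by
  rw [MarkedIdeal.transform_ideal, MarkedIdeal.transform_ideal, MarkedIdeal.deriv_ideal,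
    MarkedIdeal.deriv_mult]
  exact hπ.controlledTransform_derivIdealSheafIter_le hX hX' (M.ideal_le_pow hsupp hsnc) hr

/-- **BGMW Lemma 3.6.2** (Villamayor): "Let `(𝓘, μ)` be a marked ideal of maximal order and let
`C ⊂ supp(𝓘, μ)` be a smooth center [having snc with `E`]. Let `σ : X ← X'` be a blow-up at `C`.
Then `σᶜ(𝓘, μ)` is of maximal order" — since `𝒟^μ(σᶜ(𝓘, μ)) ⊇ σᶜ(𝒟^μ(𝓘), 0) = σ^*𝒪_X = 𝒪_{X'}`
(Lemma 3.5.3 with `r = μ`). Sheaf level, `IsOfMaxOrder` of `TangentDirections.lean`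
(Def. 3.6.1: `𝒟^μ(𝓘) = 𝒪_X`), for the induced `k`-structure on `X'`. Every characteristic.
[cite: BierstoneGrigorievMilmanWlodarczyk2011, Lemma 3.6.2] -/
theorem IsBlowup.isOfMaxOrder_transform (hX : HasFinitePresentationDifferentials φ)
    (hX' : HasFinitePresentationDifferentials (π.appTop.hom.comp φ)) (hπ : IsBlowup π C)
    {M : MarkedIdeal X} (hmax : M.IsOfMaxOrder φ) (hsupp : (C.support : Set X) ⊆ M.support)
    (hsnc : HasSNCWith M.boundary C) :
    (M.transform π C).IsOfMaxOrder (π.appTop.hom.comp φ) := by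
  rw [MarkedIdeal.isOfMaxOrder_iff] at hmax ⊢
  rw [MarkedIdeal.transform_mult, MarkedIdeal.transform_ideal, ← top_le_iff]
  have h := hπ.controlledTransform_derivIdealSheafIter_le hX hX' (M.ideal_le_pow hsupp hsnc)
    (le_refl M.mult)
  rwa [hmax, Nat.sub_self, controlledTransform_zero, Scheme.IdealSheafData.comap_top] at h

end Marked

/-! ## Schemes over `Spec k` -/

section Over

variable (k : Type u) [CommRing k] {X X' : Scheme.{u}} [X.Over (Spec (.of k))]
  [X'.Over (Spec (.of k))] (π : X' ⟶ X) [π.IsOver (Spec (.of k))]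

/-- For a morphism of `k`-schemes, the induced `k`-structure on `X'` is the given one.
[folklore] -/
theorem appTop_comp_overHom : π.appTop.hom.comp (overHom k X) = overHom k X' := by
  unfold overHom
  rw [← RingHom.comp_assoc, ← CommRingCat.hom_comp, ← Scheme.Hom.comp_appTop, comp_over]

variable {k π} [IsLocallyNoetherian X'] [LocallyOfFinitePresentation (X ↘ Spec (.of k))]
  [LocallyOfFinitePresentation (X' ↘ Spec (.of k))] {C : X.IdealSheafData}

/-- **BGMW Lemma 3.5.3** for a blow-up of schemes locally of finite presentation over
`Spec k` (`X'` locally Noetherian): `σᶜ(𝒟ʳ𝓘, μ - r) ⊆ 𝒟ʳ(σᶜ(𝓘, μ))` for `𝓘 ⊆ C^μ`, `r ≤ μ`.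
[cite: BierstoneGrigorievMilmanWlodarczyk2011, Lemma 3.5.3] -/
theorem IsBlowup.controlledTransform_derivIdealSheafIter_le_over (hπ : IsBlowup π C)
    {I : X.IdealSheafData} {μ : ℕ} (hI : I ≤ C ^ μ) {r : ℕ} (hr : r ≤ μ) :
    controlledTransform π C (derivIdealSheafIter (overHom k X) r I) (μ - r) ≤
      derivIdealSheafIter (overHom k X') r (controlledTransform π C I μ) := by
  have hX' : HasFinitePresentationDifferentials (π.appTop.hom.comp (overHom k X)) := by
    rw [appTop_comp_overHom]
    exact hasFinitePresentationDifferentials_overHom k X'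
  rw [← appTop_comp_overHom k π]
  exact hπ.controlledTransform_derivIdealSheafIter_le (hasFinitePresentationDifferentials_overHom k X)
    hX' hI hr

/-- **BGMW Lemma 3.6.2** for a blow-up of schemes locally of finite presentation over `Spec k`
(`X'` locally Noetherian): the transform of a marked ideal of maximal order by the blow-up of an
admissible centre is of maximal order. [cite: BierstoneGrigorievMilmanWlodarczyk2011, Lemma 3.6.2] -/
theorem IsBlowup.isOfMaxOrder_transform_over (hπ : IsBlowup π C) {M : MarkedIdeal X}
    (hmax : M.IsOfMaxOrder (overHom k X)) (hsupp : (C.support : Set X) ⊆ M.support)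
    (hsnc : HasSNCWith M.boundary C) :
    (M.transform π C).IsOfMaxOrder (overHom k X') := by
  have hX' : HasFinitePresentationDifferentials (π.appTop.hom.comp (overHom k X)) := by
    rw [appTop_comp_overHom]
    exact hasFinitePresentationDifferentials_overHom k X'
  rw [← appTop_comp_overHom k π]
  exact hπ.isOfMaxOrder_transform (hasFinitePresentationDifferentials_overHom k X) hX' hmax
    hsupp hsnc

end Over

/-! ## Along multiple blow-ups: all transforms of a marked ideal of maximal order are of maximal order -/

section Multiple

variable (k : Type u) [Field k] {X X' : Scheme.{u}} [X.Over (Spec (.of k))]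
  [LocallyOfFiniteType (X ↘ Spec (.of k))]

/-- Over a field `k`: if `X` is locally of finite type over `Spec k` and `σ : X' → X` is locally
of finite type, the induced `k`-structure on `X'` has finitely presented differentials.
[folklore] -/
theorem hasFinitePresentationDifferentials_appTop_comp_overHom (σ : X' ⟶ X) [LocallyOfFiniteType σ] :
    HasFinitePresentationDifferentials (σ.appTop.hom.comp (overHom k X)) := by
  letI : X'.Over (Spec (.of k)) := ⟨σ ≫ X ↘ Spec (.of k)⟩
  haveI : σ.IsOver (Spec (.of k)) := ⟨rfl⟩
  haveI : LocallyOfFiniteType (X' ↘ Spec (.of k)) :=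
    inferInstanceAs (LocallyOfFiniteType (σ ≫ X ↘ Spec (.of k)))
  rw [appTop_comp_overHom k σ]
  exact hasFinitePresentationDifferentials_of_finitePresentation _ fun U =>
    RingHom.FinitePresentation.of_finiteType.mp (finiteType_sectionsHom_overHom k X' U)

/-- **BGMW Lemma 3.6.2 along a multiple blow-up**: over a field `k`, for `X` locally
Noetherian and locally of finite type over `Spec k`, every marked ideal `Mᵢ = (Xᵢ, 𝓘ᵢ, Eᵢ, μ)` of
a multiple blow-up (`IsMultipleBlowup`, BGMW Def. 3.1.3: admissible regular centres) of a marked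
ideal `M` of maximal order is of maximal order (for the induced `k`-structure on `Xᵢ`).
[cite: BierstoneGrigorievMilmanWlodarczyk2011, Lemma 3.6.2] -/
theorem IsMultipleBlowup.isOfMaxOrder [IsLocallyNoetherian X] {M : MarkedIdeal X} {σ : X' ⟶ X}
    {M' : MarkedIdeal X'} (h : IsMultipleBlowup M σ M') (hmax : M.IsOfMaxOrder (overHom k X)) :
    M'.IsOfMaxOrder (σ.appTop.hom.comp (overHom k X)) := by
  induction h with
  | refl => rwa [id_appTop_comp]
  | @blowup X' X'' σ M' h C τ hτ hC hsupp hsnc ih =>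
    haveI := h.isLocallyNoetherian
    haveI : IsProper σ := h.isProper
    haveI : IsProper τ := hτ.isProper
    haveI : IsLocallyNoetherian X'' := LocallyOfFiniteType.isLocallyNoetherian τ
    have hX' := hasFinitePresentationDifferentials_appTop_comp_overHom k σ
    have hX'' : HasFinitePresentationDifferentials (τ.appTop.hom.comp (σ.appTop.hom.comp (overHom k X))) := by
      rw [← comp_appTop_comp]
      exact hasFinitePresentationDifferentials_appTop_comp_overHom k (τ ≫ σ)
    rw [comp_appTop_comp]
    exact hτ.isOfMaxOrder_transform hX' hX'' ih hsupp hsnc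

end Multiple

end Literature.AlgebraicGeometry.Resolution

end
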